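import Literature.NumberTheory.Automorphic.UnitaryGroupSeesawConjugation
import HarnessLib

/-!
# The see-saw conjugation element on the FIRST member: `h₀ = Res(a ⊗ 1_W) ∘ Λ_C⁻¹ ∈ Sp(W_{T_V ⊗ T_W})` for a hermitian
# isometry `a : (V, H_V′) ≅ (V, H_V)`, and the square `h₀ · (Λ_C ι′(v′ ⊗ u) Λ_C⁻¹) · h₀⁻¹ = ι((a v′ a⁻¹) ⊗ u)`

Topic `NumberTheory/Automorphic`; namespace `Literature.NumberTheory.Automorphic.UnitaryGroup` (sequel of
`UnitaryGroupSeesawConjugation`).  Definitions with bodies and proved lemmas only: no named facts, no `sorry`.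

`UnitaryGroupSeesawConjugation` §1–§3 treat a GENERAL isometry `g : (Sⁿ, H′) ≅ (Sⁿ, H)` and §4/§6 instantiate at the Kronecker
element `1_V ⊗ g` — the see-saw partner on the SECOND member of a unitary dual pair, `v ⊗ u′ ↦ v ⊗ g u′ g⁻¹` ([Kudla1984, §1]).
This file is the OTHER instance: a hermitian isometry `a : (V, H_V′) ≅ (V, H_V)` of the FIRST member acting through `a ⊗ 1_W`
(e.g. a change of frame of the hermitian space `V`, `H_V = diag dV`, `H_V′ = diag dV′`, by a general `E`-rational isometry):

* §1 (pure algebra, commutative rings `R → S`): `kroneckerGL_isometry_one` (`a ⊗ 1` is an isometry `H_V ⊗ H_W → H_V′ ⊗ H_W`),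
  `kroneckerGL_conj_one` (`(a ⊗ 1)(v′ ⊗ u)(a ⊗ 1)⁻¹ = (a v′ a⁻¹) ⊗ u`), `isometryConj_kroneckerGL_dualPair_left` (conjugation by
  `a ⊗ 1` conjugates the first member and FIXES the second), `IsQuadraticCoordinates.seesawConj_conj_pairToSymplectic_left` — the
  square `h₀ · (Λ_C ι′(v′ ⊗ u) Λ_C⁻¹) · h₀⁻¹ = ι((a v′ a⁻¹) ⊗ u)` for `h₀ = seesawConj (a ⊗ 1) C`, `(T_V ⊗ T_W) C = T_V′ ⊗ T_W`;
* §2 (number fields; the adelic dual pair `U(J_V) × U(J_W)` of `UnitaryGroupSymplecticCarriers` / `UnitaryGroupDualPairCarriers`):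
  `adelicSeesawConjLeft` (the element of `Sp(𝕎)(𝔸_F)`, mirror of `adelicSeesawConj`), `coe_adelicSeesawConjLeft`,
  `adelicSeesawConjLeft_conj` / `_conj_dualPair`, and `adelicSeesawConjLeft_mem_range`: for RATIONAL data `a = a₀ ⊗ 1`, `C = C₀ ⊗ 1`
  the element is an `F`-rational point of `Sp(𝕎)(𝔸_F)` of record — the hypothesis of Weil's `Θ`-fixing rational lift
  ([Weil1964, Chap. III n° 41 Thm 6]; `AdelicMetaplecticRationalLift.ratPointsThetaLiftCont`).

## References
* [Kudla1984] S. Kudla, *Seesaw dual reductive pairs*, Progr. Math. 46 (1984) 244–268, §1.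
* [MoeglinVignerasWaldspurger1987] C. Mœglin, M.-F. Vignéras, J.-L. Waldspurger, *Correspondances de Howe sur un corps p-adique*,
  LNM 1291 (1987), Chap. 1 I.17–I.19.
* [GelbartRogawski1991] S. Gelbart, J. Rogawski, *L-functions and Fourier–Jacobi coefficients for the unitary group U(3)*,
  Invent. Math. 105 (1991), §3.1 p. 455, §3.2.
* [Weil1964] A. Weil, *Sur certains groupes d'opérateurs unitaires*, Acta Math. 111 (1964), Chap. III n° 41 Thm 6 p. 193.
-/

set_option autoImplicit false

noncomputable section

open Matrix NumberField
open scoped Kronecker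
open Literature.RepresentationTheory.HeisenbergGroup

namespace Literature.NumberTheory.Automorphic

namespace UnitaryGroup

/-! ## 1. The Kronecker instance on the FIRST member: `a ↦ a ⊗ 1_W`, `v′ ⊗ u ↦ (a v′ a⁻¹) ⊗ u` -/

section KroneckerLeft

variable {R S : Type*} [CommRing R] [CommRing S]
variable {n m : Type*} [Fintype n] [Fintype m] [DecidableEq n] [DecidableEq m]

/-- **`a ⊗ 1_W` is an isometry `H_V ⊗ H_W → H_V′ ⊗ H_W`** for an isometry `a : H_V → H_V′` (the model
`(V, h′) ⊗ W ≅ (V, h) ⊗ W` of the see-saw on the first member). [cite: Kudla1984, §1] -/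
theorem kroneckerGL_isometry_one (σ : S →+* S) {HV HV' : Matrix n n S} (a : GL n S)
    (ha : ((a : Matrix n n S).map σ)ᵀ * HV * a = HV') (HW : Matrix m m S) :
    (((kroneckerGL (a, (1 : GL m S)) : GL (n × m) S) : Matrix (n × m) (n × m) S).map σ)ᵀ * (HV ⊗ₖ HW) *
        ((kroneckerGL (a, (1 : GL m S)) : GL (n × m) S) : Matrix (n × m) (n × m) S) = HV' ⊗ₖ HW := by
  rw [coe_kroneckerGL, Units.val_one]
  exact kronecker_isometry σ ha (one_isometry σ HW)

/-- **Mixed-product conjugation on the first member**: `(a ⊗ 1) (v ⊗ u) (a ⊗ 1)⁻¹ = (a v a⁻¹) ⊗ u` in `GL_{n × m}(S)`.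
[cite: MoeglinVignerasWaldspurger1987, Chap. 1 I.17] -/
theorem kroneckerGL_conj_one (a : GL n S) (v : GL n S) (u : GL m S) :
    kroneckerGL (a, (1 : GL m S)) * kroneckerGL (v, u) * (kroneckerGL (a, (1 : GL m S)))⁻¹ =
      kroneckerGL (a * v * a⁻¹, u) := by
  rw [← map_inv, ← map_mul, ← map_mul, Prod.inv_mk, inv_one, Prod.mk_mul_mk, Prod.mk_mul_mk, one_mul, mul_one]

/-- **`isometryConj (a ⊗ 1) (v′ ⊗ u) = (isometryConj a v′) ⊗ u`**: conjugation by `a ⊗ 1` conjugates the first member of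
the dual pair and fixes the second. [cite: Kudla1984, §1] -/
theorem isometryConj_kroneckerGL_dualPair_left (σ : S →+* S) {HV HV' : Matrix n n S} (a : GL n S)
    (ha : ((a : Matrix n n S).map σ)ᵀ * HV * a = HV') (HW : Matrix m m S) (v : unitaryGroupOfForm σ HV')
    (u : unitaryGroupOfForm σ HW) :
    isometryConj σ (kroneckerGL (a, (1 : GL m S))) (kroneckerGL_isometry_one σ a ha HW) (dualPair σ HV' HW (v, u)) =
      dualPair σ HV HW (isometryConj σ a ha v, u) :=
  Subtype.ext (kroneckerGL_conj_one a (v : GL n S) (u : GL m S))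

variable {φ : R →+* S} {Ψ : (R × R) ≃+ S} {δ : S} {d : R}

/-- **THE SEE-SAW SQUARE ON THE FIRST MEMBER.** With `h₀ = seesawConj (a ⊗ 1_W) C` (`a : H_V → H_V′` an isometry,
`(T_V ⊗ T_W) C = T_V′ ⊗ T_W`), `ι = pairToSymplectic : U(σ, H_V ⊗ H_W) →* Sp(W_{T_V ⊗ T_W})` and `ι′` likewise for
`H_V′`: `h₀ · (Λ_C ι′(v′ ⊗ u) Λ_C⁻¹) · h₀⁻¹ = ι((a v′ a⁻¹) ⊗ u)` — the first member is conjugated by `a`, the second member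
`U(σ, H_W)` is carried identically. [cite: Kudla1984, §1] -/
theorem IsQuadraticCoordinates.seesawConj_conj_pairToSymplectic_left (h : IsQuadraticCoordinates φ Ψ δ d)
    {TV TV' : Matrix n n R} {TW : Matrix m m R} (hV : TV.IsSymm) (hV' : TV'.IsSymm) (hW : TW.IsSymm) {σ : S →+* S}
    (hσφ : ∀ a, σ (φ a) = φ a) (hσδ : σ δ = -δ) {HV HV' : Matrix n n S} {HW : Matrix m m S} (hHV : HV = TV.map φ)
    (hHV' : HV' = TV'.map φ) (hHW : HW = TW.map φ) (a : GL n S) (ha : ((a : Matrix n n S).map σ)ᵀ * HV * a = HV')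
    (C : GL (n × m) R) (hC : TV ⊗ₖ TW * (C : Matrix (n × m) (n × m) R) = TV' ⊗ₖ TW)
    (v : unitaryGroupOfForm σ HV') (u : unitaryGroupOfForm σ HW) :
    h.seesawConj (n × m) (isSymm_kronecker hV hW) (isSymm_kronecker hV' hW) hσφ hσδ
          (show HV ⊗ₖ HW = (TV ⊗ₖ TW).map φ by rw [hHV, hHW, kronecker_map_map])
          (show HV' ⊗ₖ HW = (TV' ⊗ₖ TW).map φ by rw [hHV', hHW, kronecker_map_map])
          (kroneckerGL (a, (1 : GL m S))) (kroneckerGL_isometry_one σ a ha HW) C hC *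
        symplecticGroupCongr _ _ (relabelEquiv C) (polar_relabelEquiv _ C hC)
          (h.pairToSymplectic hV' hW hσφ hσδ hHV' hHW (dualPair σ HV' HW (v, u))) *
      (h.seesawConj (n × m) (isSymm_kronecker hV hW) (isSymm_kronecker hV' hW) hσφ hσδ
          (show HV ⊗ₖ HW = (TV ⊗ₖ TW).map φ by rw [hHV, hHW, kronecker_map_map])
          (show HV' ⊗ₖ HW = (TV' ⊗ₖ TW).map φ by rw [hHV', hHW, kronecker_map_map])
          (kroneckerGL (a, (1 : GL m S))) (kroneckerGL_isometry_one σ a ha HW) C hC)⁻¹ =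
    h.pairToSymplectic hV hW hσφ hσδ hHV hHW (dualPair σ HV HW (isometryConj σ a ha v, u)) := by
  rw [← isometryConj_kroneckerGL_dualPair_left σ a ha HW v u]
  exact h.seesawConj_conj_toSymplectic (n × m) _ _ hσφ hσδ _ _ _ _ C hC _

end KroneckerLeft

/-! ## 2. The adelic unitary dual pair `U(J_V) × U(J_W)`: `h₀ = seesawConj (a ⊗ 1) C` in the carriers' vocabulary -/

section DualPairAdelicLeft

variable (F E : Type) [Field F] [NumberField F] [Field E] [NumberField E] [Algebra F E] (c : E ≃ₐ[F] E) (N M : ℕ)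

/-- **THE ADELIC SEE-SAW ELEMENT ON THE FIRST MEMBER `h₀ = seesawConj (a ⊗ 1_W) C ∈ Sp(𝕎_{T_V ⊗ T_W})(𝔸_F)`** of the unitary
dual pair `U(J_V) × U(J_W)`, `J_V = T_V ⊗ 1`, `J_V′ = T_V′ ⊗ 1`, `J_W = T_W ⊗ 1`: `a : (V ⊗ 𝔸, J_V′) ≅ (V ⊗ 𝔸, J_V)` an adelic
isometry and `C ∈ GL_{N M}(𝔸_F)` with `(T_V ⊗ T_W ⊗ 1) C = T_V′ ⊗ T_W ⊗ 1` — an element of the SAME symplectic group as the images of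
`adelicDualPairToSymplectic` / `adelicPairToSymplectic`. [cite: Kudla1984, §1] -/
def adelicSeesawConjLeft [Algebra.IsQuadraticExtension F E] {δ : E} (hcδ : c δ = -δ) (hδ : δ ≠ 0) {d : F}
    (hd : δ * δ = algebraMap F E d) {TV TV' : Matrix (Fin N) (Fin N) F} {TW : Matrix (Fin M) (Fin M) F}
    (hV : TV.IsSymm) (hV' : TV'.IsSymm) (hW : TW.IsSymm) {JV JV' : Matrix (Fin N) (Fin N) E}
    {JW : Matrix (Fin M) (Fin M) E} (hJV : JV = TV.map (algebraMap F E)) (hJV' : JV' = TV'.map (algebraMap F E))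
    (hJW : JW = TW.map (algebraMap F E)) (a : GL (Fin N) (AdeleRing (𝓞 E) E))
    (ha : ((a : Matrix (Fin N) (Fin N) (AdeleRing (𝓞 E) E)).map (conjAdele F E c))ᵀ * adelicForm E N JV * a =
      adelicForm E N JV') (C : GL (Fin N × Fin M) (AdeleRing (𝓞 F) F))
    (hC : TV.map (algebraMap F (AdeleRing (𝓞 F) F)) ⊗ₖ TW.map (algebraMap F (AdeleRing (𝓞 F) F)) *
        (C : Matrix (Fin N × Fin M) (Fin N × Fin M) (AdeleRing (𝓞 F) F)) =
      TV'.map (algebraMap F (AdeleRing (𝓞 F) F)) ⊗ₖ TW.map (algebraMap F (AdeleRing (𝓞 F) F))) :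
    symplecticGroup (polar (Matrix.toLinearMap₂' (AdeleRing (𝓞 F) F)
      (TV.map (algebraMap F (AdeleRing (𝓞 F) F)) ⊗ₖ TW.map (algebraMap F (AdeleRing (𝓞 F) F))))) :=
  (isQuadraticCoordinates_adele E c hcδ hδ hd).seesawConj (Fin N × Fin M)
    (isSymm_kronecker (hV.map _) (hW.map _)) (isSymm_kronecker (hV'.map _) (hW.map _)) (σ := conjAdele F E c)
    (fun a => by rw [conjAdele_apply, AdeleRing.smul_baseChange])
    (by rw [← algebraMap_conj, RingHom.coe_coe, hcδ, map_neg])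
    (H := adelicForm E N JV ⊗ₖ adelicForm E M JW) (H' := adelicForm E N JV' ⊗ₖ adelicForm E M JW)
    (by rw [adelicForm_eq_map_map E N TV hJV, adelicForm_eq_map_map E M TW hJW, kronecker_map_map])
    (by rw [adelicForm_eq_map_map E N TV' hJV', adelicForm_eq_map_map E M TW hJW, kronecker_map_map])
    (kroneckerGL (a, (1 : GL (Fin M) (AdeleRing (𝓞 E) E))))
    (kroneckerGL_isometry_one (conjAdele F E c) a ha (adelicForm E M JW)) C hC

/-- `adelicSeesawConjLeft a C (x, y) = Res(a ⊗ 1) (x, C⁻¹ y)`. [cite: Kudla1984, §1] -/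
theorem coe_adelicSeesawConjLeft [Algebra.IsQuadraticExtension F E] {δ : E} (hcδ : c δ = -δ) (hδ : δ ≠ 0) {d : F}
    (hd : δ * δ = algebraMap F E d) {TV TV' : Matrix (Fin N) (Fin N) F} {TW : Matrix (Fin M) (Fin M) F}
    (hV : TV.IsSymm) (hV' : TV'.IsSymm) (hW : TW.IsSymm) {JV JV' : Matrix (Fin N) (Fin N) E}
    {JW : Matrix (Fin M) (Fin M) E} (hJV : JV = TV.map (algebraMap F E)) (hJV' : JV' = TV'.map (algebraMap F E))
    (hJW : JW = TW.map (algebraMap F E)) (a : GL (Fin N) (AdeleRing (𝓞 E) E))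
    (ha : ((a : Matrix (Fin N) (Fin N) (AdeleRing (𝓞 E) E)).map (conjAdele F E c))ᵀ * adelicForm E N JV * a =
      adelicForm E N JV') (C : GL (Fin N × Fin M) (AdeleRing (𝓞 F) F))
    (hC : TV.map (algebraMap F (AdeleRing (𝓞 F) F)) ⊗ₖ TW.map (algebraMap F (AdeleRing (𝓞 F) F)) *
        (C : Matrix (Fin N × Fin M) (Fin N × Fin M) (AdeleRing (𝓞 F) F)) =
      TV'.map (algebraMap F (AdeleRing (𝓞 F) F)) ⊗ₖ TW.map (algebraMap F (AdeleRing (𝓞 F) F))) :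
    ((adelicSeesawConjLeft F E c N M hcδ hδ hd hV hV' hW hJV hJV' hJW a ha C hC : symplecticGroup _) :
        ((Fin N × Fin M → AdeleRing (𝓞 F) F) × (Fin N × Fin M → AdeleRing (𝓞 F) F)) ≃ₗ[AdeleRing (𝓞 F) F]
          ((Fin N × Fin M → AdeleRing (𝓞 F) F) × (Fin N × Fin M → AdeleRing (𝓞 F) F))) =
      (relabelEquiv C).symm.trans
        ((isQuadraticCoordinates_adele E c hcδ hδ hd).resAut (Fin N × Fin M)
          (kroneckerGL (a, (1 : GL (Fin M) (AdeleRing (𝓞 E) E))))) :=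
  rfl

/-- **THE ADELIC SEE-SAW SQUARE ON THE FIRST MEMBER**: for `v′ ∈ U(J_V′)(𝔸_F)`, `u ∈ U(J_W)(𝔸_F)` and
`h₀ = adelicSeesawConjLeft a C`, `h₀ · (Λ_C toSp′(v′ ⊗ u) Λ_C⁻¹) · h₀⁻¹ = toSp((a v′ a⁻¹) ⊗ u)`,
`toSp = adelicPairToSymplectic … hJV hJW`, `toSp′ = adelicPairToSymplectic … hJV′ hJW` — conjugation by `h₀` conjugates the
`U(J_V)`-member by `a` (`adelicIsometryConj`) and fixes the `U(J_W)`-member of the dual pair. [cite: Kudla1984, §1] -/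
theorem adelicSeesawConjLeft_conj [Algebra.IsQuadraticExtension F E] {δ : E} (hcδ : c δ = -δ) (hδ : δ ≠ 0) {d : F}
    (hd : δ * δ = algebraMap F E d) {TV TV' : Matrix (Fin N) (Fin N) F} {TW : Matrix (Fin M) (Fin M) F}
    (hV : TV.IsSymm) (hV' : TV'.IsSymm) (hW : TW.IsSymm) {JV JV' : Matrix (Fin N) (Fin N) E}
    {JW : Matrix (Fin M) (Fin M) E} (hJV : JV = TV.map (algebraMap F E)) (hJV' : JV' = TV'.map (algebraMap F E))
    (hJW : JW = TW.map (algebraMap F E)) (a : GL (Fin N) (AdeleRing (𝓞 E) E))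
    (ha : ((a : Matrix (Fin N) (Fin N) (AdeleRing (𝓞 E) E)).map (conjAdele F E c))ᵀ * adelicForm E N JV * a =
      adelicForm E N JV') (C : GL (Fin N × Fin M) (AdeleRing (𝓞 F) F))
    (hC : TV.map (algebraMap F (AdeleRing (𝓞 F) F)) ⊗ₖ TW.map (algebraMap F (AdeleRing (𝓞 F) F)) *
        (C : Matrix (Fin N × Fin M) (Fin N × Fin M) (AdeleRing (𝓞 F) F)) =
      TV'.map (algebraMap F (AdeleRing (𝓞 F) F)) ⊗ₖ TW.map (algebraMap F (AdeleRing (𝓞 F) F)))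
    (v : adelic F E c N JV') (u : adelic F E c M JW) :
    adelicSeesawConjLeft F E c N M hcδ hδ hd hV hV' hW hJV hJV' hJW a ha C hC *
        symplecticGroupCongr _ _ (relabelEquiv C) (polar_relabelEquiv _ C hC)
          (adelicPairToSymplectic F E c N M hcδ hδ hd hV' hW hJV' hJW
            (dualPair (conjAdele F E c) (adelicForm E N JV') (adelicForm E M JW) (v, u))) *
      (adelicSeesawConjLeft F E c N M hcδ hδ hd hV hV' hW hJV hJV' hJW a ha C hC)⁻¹ =
    adelicPairToSymplectic F E c N M hcδ hδ hd hV hW hJV hJW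
      (dualPair (conjAdele F E c) (adelicForm E N JV) (adelicForm E M JW) (adelicIsometryConj F E c N a ha v, u)) :=
  (isQuadraticCoordinates_adele E c hcδ hδ hd).seesawConj_conj_pairToSymplectic_left (hV.map _) (hV'.map _) (hW.map _)
    _ _ (adelicForm_eq_map_map E N TV hJV) (adelicForm_eq_map_map E N TV' hJV') (adelicForm_eq_map_map E M TW hJW)
    a ha C hC v u

/-- The same square with `adelicDualPairToSymplectic` (`= adelicPairToSymplectic ∘ dualPair`, `rfl`). [cite: Kudla1984, §1] -/
theorem adelicSeesawConjLeft_conj_dualPair [Algebra.IsQuadraticExtension F E] {δ : E} (hcδ : c δ = -δ) (hδ : δ ≠ 0)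
    {d : F} (hd : δ * δ = algebraMap F E d) {TV TV' : Matrix (Fin N) (Fin N) F} {TW : Matrix (Fin M) (Fin M) F}
    (hV : TV.IsSymm) (hV' : TV'.IsSymm) (hW : TW.IsSymm) {JV JV' : Matrix (Fin N) (Fin N) E}
    {JW : Matrix (Fin M) (Fin M) E} (hJV : JV = TV.map (algebraMap F E)) (hJV' : JV' = TV'.map (algebraMap F E))
    (hJW : JW = TW.map (algebraMap F E)) (a : GL (Fin N) (AdeleRing (𝓞 E) E))
    (ha : ((a : Matrix (Fin N) (Fin N) (AdeleRing (𝓞 E) E)).map (conjAdele F E c))ᵀ * adelicForm E N JV * a =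
      adelicForm E N JV') (C : GL (Fin N × Fin M) (AdeleRing (𝓞 F) F))
    (hC : TV.map (algebraMap F (AdeleRing (𝓞 F) F)) ⊗ₖ TW.map (algebraMap F (AdeleRing (𝓞 F) F)) *
        (C : Matrix (Fin N × Fin M) (Fin N × Fin M) (AdeleRing (𝓞 F) F)) =
      TV'.map (algebraMap F (AdeleRing (𝓞 F) F)) ⊗ₖ TW.map (algebraMap F (AdeleRing (𝓞 F) F)))
    (v : adelic F E c N JV') (u : adelic F E c M JW) :
    adelicSeesawConjLeft F E c N M hcδ hδ hd hV hV' hW hJV hJV' hJW a ha C hC *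
        symplecticGroupCongr _ _ (relabelEquiv C) (polar_relabelEquiv _ C hC)
          (adelicDualPairToSymplectic F E c N M hcδ hδ hd hV' hW hJV' hJW (v, u)) *
      (adelicSeesawConjLeft F E c N M hcδ hδ hd hV hV' hW hJV hJV' hJW a ha C hC)⁻¹ =
    adelicDualPairToSymplectic F E c N M hcδ hδ hd hV hW hJV hJW (adelicIsometryConj F E c N a ha v, u) :=
  adelicSeesawConjLeft_conj F E c N M hcδ hδ hd hV hV' hW hJV hJV' hJW a ha C hC v u

/-- **`h₀ = adelicSeesawConjLeft (a₀ ⊗ 1) (C₀ ⊗ 1)` OF RATIONAL DATA IS `F`-RATIONAL**: for `a = a₀ ⊗ 1` (`a₀ ∈ GL_N(E)`, entries in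
the CM field — a GENERAL `F`-point is allowed), `C = C₀ ⊗ 1` (`C₀ ∈ GL_{N M}(F)`) and `det T_V, det T_W ≠ 0`,
`adelicSeesawConjLeft a C ∈ ((transportSp (T_V.map ι ⊗ₖ T_W.map ι) hT).comp (mapHom ι)).range`, `ι = algebraMap F 𝔸_F` — the
`F`-rational points of `Sp(𝕎)(𝔸_F)` of record (`UnitaryGroupSymplecticRationalPoints`), i.e. exactly the hypothesis of Weil's
`Θ`-fixing rational lift [Weil1964, Chap. III n° 41 Thm 6 p. 193] (`ratPointsThetaLiftCont`).
[cite: Weil1964, Chap. III n° 41 Thm 6 p. 193] -/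
theorem adelicSeesawConjLeft_mem_range [Algebra.IsQuadraticExtension F E] {δ : E} (hcδ : c δ = -δ) (hδ : δ ≠ 0)
    {d : F} (hd : δ * δ = algebraMap F E d) {TV TV' : Matrix (Fin N) (Fin N) F} {TW : Matrix (Fin M) (Fin M) F}
    (hV : TV.IsSymm) (hV' : TV'.IsSymm) (hW : TW.IsSymm) (hTVd : IsUnit TV.det) (hTWd : IsUnit TW.det)
    (hT : IsUnit (TV.map (algebraMap F (AdeleRing (𝓞 F) F)) ⊗ₖ TW.map (algebraMap F (AdeleRing (𝓞 F) F))).det)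
    {JV JV' : Matrix (Fin N) (Fin N) E} {JW : Matrix (Fin M) (Fin M) E} (hJV : JV = TV.map (algebraMap F E))
    (hJV' : JV' = TV'.map (algebraMap F E)) (hJW : JW = TW.map (algebraMap F E))
    {a : GL (Fin N) (AdeleRing (𝓞 E) E)} {a₀ : GL (Fin N) E}
    (haa₀ : (a : Matrix (Fin N) (Fin N) (AdeleRing (𝓞 E) E)) =
      ((a₀ : GL (Fin N) E) : Matrix (Fin N) (Fin N) E).map (algebraMap E (AdeleRing (𝓞 E) E)))
    (ha : ((a : Matrix (Fin N) (Fin N) (AdeleRing (𝓞 E) E)).map (conjAdele F E c))ᵀ * adelicForm E N JV * a =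
      adelicForm E N JV') {C : GL (Fin N × Fin M) (AdeleRing (𝓞 F) F)} {C₀ : GL (Fin N × Fin M) F}
    (hCC₀ : (C : Matrix (Fin N × Fin M) (Fin N × Fin M) (AdeleRing (𝓞 F) F)) =
      ((C₀ : GL (Fin N × Fin M) F) : Matrix (Fin N × Fin M) (Fin N × Fin M) F).map (algebraMap F (AdeleRing (𝓞 F) F)))
    (hC : TV.map (algebraMap F (AdeleRing (𝓞 F) F)) ⊗ₖ TW.map (algebraMap F (AdeleRing (𝓞 F) F)) *
        (C : Matrix (Fin N × Fin M) (Fin N × Fin M) (AdeleRing (𝓞 F) F)) =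
      TV'.map (algebraMap F (AdeleRing (𝓞 F) F)) ⊗ₖ TW.map (algebraMap F (AdeleRing (𝓞 F) F))) :
    adelicSeesawConjLeft F E c N M hcδ hδ hd hV hV' hW hJV hJV' hJW a ha C hC ∈
      ((SymplecticMatrix.transportSp
          (TV.map (algebraMap F (AdeleRing (𝓞 F) F)) ⊗ₖ TW.map (algebraMap F (AdeleRing (𝓞 F) F))) hT).comp
        (SymplecticMatrix.mapHom (algebraMap F (AdeleRing (𝓞 F) F)))).range :=
  seesawConj_adele_mem_range F E c hcδ hδ hd (isSymm_kronecker hV hW) (isSymm_kronecker hV' hW)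
    (SpTransport.isUnit_det_kronecker hTVd hTWd) (kronecker_map_map _ TV TW) (kronecker_map_map _ TV' TW) _ _ hT
    _ _ (g₀ := kroneckerGL (a₀, (1 : GL (Fin M) E)))
    (by
      show (a : Matrix (Fin N) (Fin N) (AdeleRing (𝓞 E) E)) ⊗ₖ
          ((1 : GL (Fin M) (AdeleRing (𝓞 E) E)) : Matrix (Fin M) (Fin M) (AdeleRing (𝓞 E) E)) =
        (((a₀ : GL (Fin N) E) : Matrix (Fin N) (Fin N) E) ⊗ₖ ((1 : GL (Fin M) E) : Matrix (Fin M) (Fin M) E)).map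
          (algebraMap E (AdeleRing (𝓞 E) E))
      rw [Units.val_one, Units.val_one, haa₀, ← Matrix.map_one (algebraMap E (AdeleRing (𝓞 E) E)) (map_zero _)
        (map_one _), kronecker_map_map])
    _ hCC₀ hC

end DualPairAdelicLeft

end UnitaryGroup

end Literature.NumberTheory.Automorphic

end
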